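import Literature.MathematicalPhysics.QuantumFieldTheory.Balaban1983to89.B9CubeDirInverseBondCMemberRowsAtRecordY
import Literature.MathematicalPhysics.QuantumFieldTheory.Balaban1983to89.B9CubeSequence408MirrorsStencil
import Literature.MathematicalPhysics.QuantumFieldTheory.Balaban1983to89.B9KnitCubeRowAgreementY
import Literature.MathematicalPhysics.QuantumFieldTheory.Balaban1983to89.B9CubeDirInverseKnitCubeLawsY
import Literature.MathematicalPhysics.QuantumFieldTheory.Balaban1983to89.B9BackgroundsKLevelV1

/-!
# `Balaban1983to89.B9Cor36GDirBondCutSetExtent` — [Balaban1985BackgroundPropagators] p. 408 l. −3 – p. 409 l. 1, p. 410 l. 14–15 («Ω₀(□) ⊂ □⁵», «the operators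
# G′_□(U), C_□(U), G_□(U) depend on U restricted to Ω₀(□) ⊂ □̃⁵»): THE EXTENT OF THE CANONICAL CUT SET `bondCutSetY i □` OF THE DIRICHLET BOND LETTER OF RECORD —
# every site of it is, in every MIRRORED direction, within torus distance `w₁ + 4·S_{k′} + 4` of the centre of `β`; hence (all directions mirrored) its chart preimage lies in
# the ALIGNED cube `torusCube (cornerYCut i □) (nD·S_j)` of `nD = 4R + 16L + 1` big `j`-blocks whose corner is on the big-`j`-block grid (seat dag-n06-c g37, FILE (T1) of LOCATED-42 §2:
# the SIZE half of the (3.35) datum inscription — the one geometric statement ✓`B9BondReadDomainsPinY` left open, «Ω₀(□) ⊂ □̃⁵» in the tree's fat-collar edition)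

statement-level skeleton of published theorems with citation tags; proofs where landed; nothing here is a claim about the Yang–Mills mass gap

CITATION HEADER (lean-in-tree rule).  B9 = T. Bałaban, *Propagators for lattice gauge theories in a background field*, Commun. Math. Phys. **99** (1985) 389–434
[Balaban1985BackgroundPropagators] (held `paper:balaban1985-cmp99-background-propagators`; journal page = PDF page + 388): p. 408 («Ω_n(□) is a cube with a center at the
center of □ … dist(Ω₀(□)ᶜ, □⁴) < 2R₀M₀Lʲη, hence Ω₀(□) ⊂ □⁵»), p. 409 l. 1–5, p. 410 l. 14–15, (3.12)–(3.14) p. 393 («Q … is a local operator»), (3.35) p. 396 («□ is a union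
of several big blocks … its size in the lattice T_η is O(1)MLʲη»); T. Bałaban, *Averaging operations for lattice gauge theories*, Commun. Math. Phys. **98** (1985) 17–51
[Balaban1985Averaging], p. 24 (the double block `B^j(c₋) ∪ B^j(c₊)`); [Balaban1983RegularityDecay] (2.42) p. 584 (the mirror box).  Rows B9.Cor3.6 × B9.p408-collars (cells only).

WHY THIS FILE (cell `pub-ymgap`, node N06 [B9]; LOCATED-42 §2 (T1)).  ✓D1 `B9Cor36GDirBondDatumOfReg335Cube.datumBUY_of_regYP335` turns the heads' regime into the (3.35) bond
datum `DatumBUY` GIVEN an aligned class cube `torusCube c₀ (n·S_{j′}) ⊇ chart⁻¹(bondCutSetY i □)`.  This file supplies the SIZE half of that inscription, unconditionally in the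
member's geometry once every direction of `□` is mirrored (the heads' row `hMirA`, director-ym №690 (V1)): `bondCutSetY i □ = nearAPinCY □ Ω₀(□) ∪ (± e_μ)` with
`nearAPinCY = bondReadSetY ∪ knitSrcSetCY` is traced back to `Ω₀(□)` — the reading set is `Ω₀(□)`, its `±e_κ`, `−e_κ+e_κ′` translates and its `𝔅_□`-block hull (`⊆ Ω₀(□)`,
✓`blkHullCubeY_dirDomY_subset`); a knit source shares a double `L^n`-block (`n ≤ k′ + 1`, ✓`lev_ends_bounds` for the cube sequence) with a bond issuing from `Ω₀(□)`; and `Ω₀(□)`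
itself has half-width `w₁ + 3S_{k′} + 1` (✓`circAbs_le_of_mem_dirDomC`, this seat g32).  The LEVEL half (which sites of that cube have which member level) is NOT here: by
LOCATED-42 it FAILS at shallow cubes and holds under the separation hypothesis `SepY` (next file).

WHAT IS PROVED (2 bookkeeping `def`s with bodies — `nHalfY`, `cornerYCut`; theorems; 0 sorry; 0 `def … : Prop`; 0 new named facts; standard axioms): §1 torus arithmetic
(`circAbs_sub_le_add`, `circAbs_intCast_val_sub`); §2 `circAbs_le_of_mem_bondReadSetY_dirDomY`, `lvl_le_kTop_succ_of_mem_knitDepP` (index bonds of the cube sequence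
whose double block is inhabited have level `≤ k′ + 1`), `two_mul_pow_le_sTop`, `chartY_transl_zero_val`, `circAbs_src_sub_src_le_of_mem_knitDepP` (two bonds of one
dependency set are within `2Lʲ − 1`), `circAbs_le_of_mem_knitSrcSetCY_dirDomY`, `circAbs_le_of_mem_nearAPinCY_dirDomY`, ★`circAbs_le_of_mem_bondCutSetY` (half-width
`w₁ + 4S_{k′} + 4`); §3 `four_mul_sum_sI_Ico_le`, `sTop_le_L_mul_sI`, `nHalfY`, ★★`extent_lt_nHalf` (`w₁ + 4S_{k′} + 4 + hf_j < (nHalfY + 1)·S_j`, `nHalfY = 2R + 8L`),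
`cornerYCut`, `bigSide_dvd_cornerYCut_val` (✓D1's `hc₀`), `cornerYCut_val_eq`, `mem_torusCube_cornerYCut_iff`, ★★★`bondCutSetY_subset_torusCube` (✓D1's `hbox`:
`chart⁻¹(bondCutSetY i □) ⊆ torusCube (cornerYCut i □) ((2·nHalfY+1)·S_j)`), `wit_mem_torusCube` + `levV1_wit` (the level-`j` witness of `β` lies in it: ✓D1's `hmeet` at
`j′ = j`), ★`circAbs_le_of_mem_torusCube_cornerYCut` (every site of the cube is within `nHalfY·S_j + hf_j` of the centre — the input of the LEVEL half).

HONEST SCOPE ∕ NOT CLAIMED.  Pure lattice geometry of landed definitions; crude constants (`2R + 8L` per side where `≈ 1.25R + 7L` would do); no estimate, no level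
statement, no datum.  Nothing on `d = 4`, the continuum, reflection positivity or the mass gap; NOT a node discharge; count-neutral; no row head changes.  NEW file; nothing
landed is modified.  `--supports stmt-QuantumFields-27239`.

RELATED IN THE TREE, NOT DUPLICATED (searched 2026-09-01: `rg 'bondCutSetY_subset|mem_bondCutSetY|nearAPinCY_subset|knitSrcSetCY_subset|cornerYCut|nHalfY'` over `Literature/` +
`Summits/` = ∅ apart from the definitions' own files): ✓`B9CubeSequence408MirrorsStencil` (`circAbs_le_of_mem_dirDomC`, `hQ_of_box`: the extent of `Ω₀(□)` alone, USED),
✓`B9BondReadDomainsPinY` (`nearAPinCY`, `knitSrcSetCY`), ✓`B9CubeDirInverseBondCMemberRowsAtRecordY` §5 (`bondCutSetY`), ✓`B9KnitCubeRowAgreementY` (`ends_of_mem_knitDepP`, USED),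
✓`B9BackgroundsKLevelV1` (`torusCube`, `mem_torusCube_iff_blk`).
-/

noncomputable section

namespace Literature.MathematicalPhysics.QuantumFieldTheory.Balaban1983to89.B9Cor36GDirBondCutSetExtent

open B7Prop1Explicit renaming Site → LSite
open B7Prop1Explicit (e e_apply)
open B7Prop1Local (InBox loK bondHiK)
open B10Eq27TorusAxialLog (transl transl_apply)
open B4Reflection242 (boxDom mem_boxDom blk)
open B4TorusKernel.MultiPeriod (torusSupNorm circAbs centre abs_add_mul_centre circAbs_nonneg circAbs_add_mul circAbs_le_abs)
open B4Sect5Torus (circAbs_add_le)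
open B6MultiLevelBoxOperator (N0 bigSide bigSide_succ one_le_bigSide)
open B6MultiLevelTorusOperator (twrap tshift one_le_N0 tshift_val unitVec N0_eq_bigSide_mul)
open B6Cover236MultiLevelBlocks (cubes wit lev_wit blk_wit)
open B6GlobalChartV1 (PV toBox boxEquiv)
open B6KLevelCensusIndexV1 (KIdx)
open B6MultiLevelTorusMirrorL0 (sTop one_le_sTop)
open B6MultiLevelTorusMirrorDecay (pow_dvd_sTop)
open B9CubeSequence408 (sI hf wid collar ctrC sI_pos collar_nonneg two_mul_hf_add_one sI_succ abs_sub_ctrC_le_of_blk_eq)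
open B9CubeSequence408Mirrors (kTop kTop_le one_le_kTop mirC)
open B9CubeSequence408MirrorsStencil (circAbs_le_of_mem_dirDomC shiftY_eq_tshift circAbs_tshift_sub_le circAbs_tshift_tshift_sub_le three_le_sTop)
open B9CubeLettersOpsL0 (oddMh cubeFamY levCubeY)
open B9CubeLettersBondOpsL0 (IBondCubeY)
open B9Cor35GpDirInputsAtOne (dirDomY)
open B9CubeDirInverseBondLocalityAtRecordY (bondReadSetY)
open B9CubeDirInverseKnitCubeLawsY (blkHullCubeY_dirDomY_subset)
open B9BondReadDomainsPinY (nearAPinCY knitSrcSetCY)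
open B9CubeDirInverseBondCMemberRowsAtRecordY (bondCutSetY)
open B9Eq3115KnitCubeLetterY (zSrcP knitDepP)
open B9KnitCubeRowAgreementY (ends_of_mem_knitDepP)
open B9CubeBondRowAgreementNearH (side_conds)
open B9BackgroundsKLevelV1 (torusCube)
open Node00 (SiteY FBondY toKT shiftY)
open Node00.OpsYNablaBridge (chartY)

variable {d ℓ : ℕ} {hd : 1 ≤ d + 1} {hL : Odd (ℓ + 1) ∧ 1 < ℓ + 1} {b₀ b₁ : ℝ}

/-! ## §1  Torus arithmetic -/

section Arith

/-- torus triangle inequality about a centre: `circAbs(a − c) ≤ circAbs(b − c) + circAbs(a − b)`. [cite: Balaban1983RegularityDecay, p.572 («periodic conditions»), bookkeeping] -/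
theorem circAbs_sub_le_add {N : ℕ} (hN : 1 ≤ N) (a b c : ℤ) : circAbs N (a - c) ≤ circAbs N (b - c) + circAbs N (a - b) := by
  have h := circAbs_add_le hN (b - c) (a - b)
  rwa [show b - c + (a - b) = a - c by ring] at h

/-- the box coordinate of an integer translate: `val ((z : ℤ) : ZMod N) ≡ z (mod N)`, so torus distances are read on `z`. [cite: Balaban1984PropagatorsII, (2.1) p.224, bookkeeping] -/
theorem circAbs_intCast_val_sub {N : ℕ} [NeZero N] (z a : ℤ) : circAbs N ((((z : ZMod N)).val : ℤ) - a) = circAbs N (z - a) := by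
  rw [ZMod.val_intCast, Int.emod_def, show z - (N : ℤ) * (z / (N : ℤ)) - a = (z - a) + (N : ℤ) * (-(z / (N : ℤ))) by ring, circAbs_add_mul]

end Arith

/-! ## §2  The extent of the canonical cut set `bondCutSetY i □` in a mirrored direction -/

section Extent

variable (i : KIdx d ℓ hd hL b₀ b₁) (q : ↥(cubes (toKT i).D.toDomains))

/-- the reading set of `Ω₀(□)`: within `w₁ + 3S_{k′} + 3` of the centre (sites of `Ω₀(□)`, their `±e_κ`, `−e_κ+e_κ′` translates, the block hull `⊆ Ω₀(□)`).
[cite: Balaban1985BackgroundPropagators, p.410 l.14–15, (3.10) p.392, p.394 l.30–33, p.408] -/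
theorem circAbs_le_of_mem_bondReadSetY_dirDomY {z : SiteY i} (hz : z ∈ bondReadSetY i q (dirDomY i q)) {μ : Fin (d + 1)} (hμ : mirC q μ = true) :
    circAbs ((toKT i).NB μ) (z.1 μ - ctrC q μ) ≤ wid ℓ (toKT i).Mh (toKT i).R q.1.1 1 + 3 * sTop ℓ (toKT i).Mh (kTop q) + 3 := by
  have hMh := (toKT i).hMh
  have hP := (toKT i).hP
  have hN : 1 ≤ (toKT i).NB μ := one_le_N0 hMh hP μ
  have base : ∀ w : SiteY i, w ∈ dirDomY i q → circAbs ((toKT i).NB μ) (w.1 μ - ctrC q μ) ≤ wid ℓ (toKT i).Mh (toKT i).R q.1.1 1 + 3 * sTop ℓ (toKT i).Mh (kTop q) + 1 :=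
    fun w hw => circAbs_le_of_mem_dirDomC hMh hP q hw hμ
  unfold bondReadSetY at hz
  simp only [Finset.mem_union, Finset.mem_image, Finset.mem_product, Finset.mem_univ, true_and] at hz
  rcases hz with (((h0 | ⟨⟨κ, w⟩, hw, rfl⟩) | ⟨⟨κ, w⟩, hw, rfl⟩) | ⟨⟨⟨κ, κ'⟩, w⟩, hw, rfl⟩) | hh
  · linarith [base z h0]
  · have h1 := circAbs_tshift_sub_le hMh hP w κ μ 1 (by norm_num)
    rw [← (shiftY_eq_tshift i κ w).1] at h1
    linarith [base w hw, circAbs_sub_le_add hN ((shiftY i κ w).1 μ) (w.1 μ) (ctrC q μ)]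
  · have h1 := circAbs_tshift_sub_le hMh hP w κ μ (-1) (by norm_num)
    rw [← (shiftY_eq_tshift i κ w).2] at h1
    linarith [base w hw, circAbs_sub_le_add hN (((shiftY i κ).symm w).1 μ) (w.1 μ) (ctrC q μ)]
  · have h1 := circAbs_tshift_tshift_sub_le hMh hP w κ κ' μ (-1) 1 (by norm_num) (by norm_num)
    rw [← (shiftY_eq_tshift i κ w).2, ← (shiftY_eq_tshift i κ' ((shiftY i κ).symm w)).1] at h1
    linarith [base w hw, circAbs_sub_le_add hN ((shiftY i κ' ((shiftY i κ).symm w)).1 μ) (w.1 μ) (ctrC q μ)]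
  · linarith [base z (blkHullCubeY_dirDomY_subset i q hh)]


/-- the cube sequence's index bonds have level `≤ k′ + 1` once their double block carries a fine bond (`lev_□ ≥ j(ι) − 1` at its base points, `lev_□ ≤ k′`).
[cite: Balaban1984PropagatorsII, (2.1)–(2.4) p.224; Balaban1985BackgroundPropagators, p.408 («{Ω_n(□)}_{n=0,…,j+1}»)] -/
theorem lvl_le_kTop_succ_of_mem_knitDepP (ι : IBondCubeY i q) {b : FBondY i} (hb : b ∈ knitDepP i ι.1) : (ι.1.1 : ℕ) ≤ kTop q + 1 := by
  obtain ⟨-, -, -, -, hRM⟩ := side_conds i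
  have h1 := (B6Ineq2142KLevelV1L0.lev_ends_bounds i.hN (cubeFamY i q) i.hk hRM ι (ends_of_mem_knitDepP i ι.1 hb)).1
  have h2 : levCubeY i q (toBox i.hN b.src) ≤ kTop q :=
    B9CubeSequence408Mirrors.lev_cubeFam_le_kTop (hL := hL.1) (hM := oddMh i) (hMh := (toKT i).hMh) (hP := (toKT i).hP) q _
  change (ι.1.1 : ℕ) - 1 ≤ levCubeY i q (toBox i.hN b.src) at h1
  omega

/-- `2·L^{n} ≤ S_{k′}` for `n ≤ k′ + 1` (`S_{k′} = M_h·L^{k′+1}`, `M_h ≥ 8`). [cite: Balaban1984PropagatorsII, (2.1) p.224, bookkeeping] -/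
theorem two_mul_pow_le_sTop {n : ℕ} (hn : n ≤ kTop q + 1) : 2 * (((ℓ + 1 : ℕ) : ℤ)) ^ n ≤ sTop ℓ (toKT i).Mh (kTop q) := by
  have h8 : 8 ≤ (toKT i).Mh := i.hM8
  have hpow : (ℓ + 1) ^ n ≤ (ℓ + 1) ^ (kTop q + 1) := Nat.pow_le_pow_right (Nat.succ_pos ℓ) hn
  have h : 2 * (ℓ + 1) ^ n ≤ (toKT i).Mh * (ℓ + 1) ^ (kTop q + 1) := Nat.mul_le_mul (by omega) hpow
  show 2 * (((ℓ + 1 : ℕ) : ℤ)) ^ n ≤ ((bigSide ℓ (toKT i).Mh (kTop q) : ℕ) : ℤ)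
  unfold bigSide; exact_mod_cast h

/-- the box coordinates of the source of a dependency bond: `chart(b₋)_ν ≡ x_ν (mod N₀)` for the integer point `x` of the double block it is read from.
[cite: Balaban1985Averaging, p.24; Balaban1984PropagatorsII, (2.1) p.224, bookkeeping] -/
theorem chartY_transl_zero_val (x : LSite (d + 1)) (ν : Fin (d + 1)) :
    (chartY i (transl (0 : Site (PV d ℓ i.m i.K hd hL) 0) x)).1 ν = ((((x ν : ℤ) : ZMod ((PV d ℓ i.m i.K hd hL).sitesPerDir 0))).val : ℤ) := by
  show (((transl (0 : Site (PV d ℓ i.m i.K hd hL) 0) x ν).val : ℤ)) = _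
  rw [transl_apply, show (0 : Site (PV d ℓ i.m i.K hd hL) 0) ν = 0 from rfl, zero_add]

/-- two bonds of ONE dependency set `knitDepP i (j, c)` have sources within `2Lʲ − 1` of each other in every coordinate (torus distance).
[cite: Balaban1985Averaging, p.24 (the double block `B^j(c₋) ∪ B^j(c₊)`); Balaban1985BackgroundPropagators, (3.12)–(3.14) p.393] -/
theorem circAbs_src_sub_src_le_of_mem_knitDepP (p : (j : Fin (i.k + 1)) × PBond (PV d ℓ i.m i.K hd hL) (j : ℕ)) {b b' : FBondY i}
    (hb : b ∈ knitDepP i p) (hb' : b' ∈ knitDepP i p) (ν : Fin (d + 1)) :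
    circAbs ((toKT i).NB ν) ((chartY i b'.src).1 ν - (chartY i b.src).1 ν) ≤ 2 * (((ℓ + 1 : ℕ) : ℤ)) ^ (p.1 : ℕ) - 1 := by
  obtain ⟨x, μ, hx, -, rfl⟩ := hb
  obtain ⟨x', μ', hx', -, rfl⟩ := hb'
  have hNB : (toKT i).NB ν = (PV d ℓ i.m i.K hd hL).sitesPerDir 0 := i.hN ν
  haveI : NeZero ((PV d ℓ i.m i.K hd hL).sitesPerDir 0) := NeZero.of_pos (lt_trans zero_lt_one ((PV d ℓ i.m i.K hd hL).one_lt_sitesPerDir 0))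
  have hN1 : 1 ≤ (PV d ℓ i.m i.K hd hL).sitesPerDir 0 := le_of_lt ((PV d ℓ i.m i.K hd hL).one_lt_sitesPerDir 0)
  simp only [chartY_transl_zero_val, hNB]
  rw [circAbs_intCast_val_sub, show x' ν - ((((x ν : ℤ) : ZMod ((PV d ℓ i.m i.K hd hL).sitesPerDir 0))).val : ℤ) =
    -(((((x ν : ℤ) : ZMod ((PV d ℓ i.m i.K hd hL).sitesPerDir 0))).val : ℤ) - x' ν) by ring]
  refine (B4Sect5Torus.circAbs_neg_le hN1 _).trans ?_
  rw [circAbs_intCast_val_sub]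
  refine (circAbs_le_abs hN1 _).trans ?_
  obtain ⟨h1, h2⟩ := hx ν
  obtain ⟨h1', h2'⟩ := hx' ν
  simp only [loK] at h1 h1'
  simp only [bondHiK] at h2 h2'
  have hLc : ((ℓ + 1 : ℕ) : ℤ) = (ℓ : ℤ) + 1 := by push_cast; ring
  rw [abs_le]
  split_ifs at h2 h2' <;> constructor <;> nlinarith

/-- the knit sources of `Ω₀(□)`: within `w₁ + 4S_{k′} + 1` of the centre (a source shares a double `Lⁿ`-block, `n ≤ k′ + 1`, `2Lⁿ ≤ S_{k′}`, with a bond issuing from `Ω₀(□)`).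
[cite: Balaban1985BackgroundPropagators, (3.12)–(3.14) p.393 («Q … is a local operator»), p.410 l.14–15; Balaban1985Averaging, p.24] -/
theorem circAbs_le_of_mem_knitSrcSetCY_dirDomY {z : SiteY i} (hz : z ∈ knitSrcSetCY i q (dirDomY i q)) {μ : Fin (d + 1)} (hμ : mirC q μ = true) :
    circAbs ((toKT i).NB μ) (z.1 μ - ctrC q μ) ≤ wid ℓ (toKT i).Mh (toKT i).R q.1.1 1 + 4 * sTop ℓ (toKT i).Mh (kTop q) + 1 := by
  classical
  have hMh := (toKT i).hMh
  have hP := (toKT i).hP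
  have hN : 1 ≤ (toKT i).NB μ := one_le_N0 hMh hP μ
  unfold knitSrcSetCY at hz
  simp only [Finset.mem_filter, Finset.mem_univ, true_and] at hz
  obtain ⟨ι, ⟨b, hb, hbS⟩, b', hb', rfl⟩ := hz
  have h0 : circAbs ((toKT i).NB μ) ((chartY i b.src).1 μ - ctrC q μ) ≤ wid ℓ (toKT i).Mh (toKT i).R q.1.1 1 + 3 * sTop ℓ (toKT i).Mh (kTop q) + 1 :=
    circAbs_le_of_mem_dirDomC hMh hP q hbS hμ
  have h1 := circAbs_src_sub_src_le_of_mem_knitDepP i ι.1 hb hb' μ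
  have h2 := two_mul_pow_le_sTop i q (lvl_le_kTop_succ_of_mem_knitDepP i q ι hb)
  linarith [circAbs_sub_le_add hN ((chartY i b'.src).1 μ) ((chartY i b.src).1 μ) (ctrC q μ)]

/-- the pinned bond reading domain `nearAPinCY □ Ω₀(□)`: within `w₁ + 4S_{k′} + 3` of the centre. [cite: Balaban1985BackgroundPropagators, p.410 l.14–15 («Ω₀(□) ⊂ □̃⁵»), p.408] -/
theorem circAbs_le_of_mem_nearAPinCY_dirDomY {z : SiteY i} (hz : z ∈ nearAPinCY i q (dirDomY i q)) {μ : Fin (d + 1)} (hμ : mirC q μ = true) :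
    circAbs ((toKT i).NB μ) (z.1 μ - ctrC q μ) ≤ wid ℓ (toKT i).Mh (toKT i).R q.1.1 1 + 4 * sTop ℓ (toKT i).Mh (kTop q) + 3 := by
  have hs : 1 ≤ sTop ℓ (toKT i).Mh (kTop q) := one_le_sTop (ℓ := ℓ) (k' := kTop q) (toKT i).hMh
  unfold nearAPinCY at hz
  rcases Finset.mem_union.1 hz with h | h
  · linarith [circAbs_le_of_mem_bondReadSetY_dirDomY i q h hμ]
  · linarith [circAbs_le_of_mem_knitSrcSetCY_dirDomY i q h hμ]

/-- ★ **THE EXTENT OF THE CANONICAL CUT SET**: in a mirrored direction every site of `bondCutSetY i □` is within `w₁ + 4S_{k′} + 4` of the centre of `β` (torus distance).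
[cite: Balaban1985BackgroundPropagators, p.408 («Ω₀(□) ⊂ □⁵»), p.410 l.14–15, p.409 l.1–5] -/
theorem circAbs_le_of_mem_bondCutSetY {z : SiteY i} (hz : z ∈ bondCutSetY i q) {μ : Fin (d + 1)} (hμ : mirC q μ = true) :
    circAbs ((toKT i).NB μ) (z.1 μ - ctrC q μ) ≤ wid ℓ (toKT i).Mh (toKT i).R q.1.1 1 + 4 * sTop ℓ (toKT i).Mh (kTop q) + 4 := by
  have hMh := (toKT i).hMh
  have hP := (toKT i).hP
  have hN : 1 ≤ (toKT i).NB μ := one_le_N0 hMh hP μ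
  unfold bondCutSetY at hz
  simp only [Finset.mem_union, Finset.mem_image, Finset.mem_product, Finset.mem_univ, true_and] at hz
  rcases hz with (h0 | ⟨⟨κ, w⟩, hw, rfl⟩) | ⟨⟨κ, w⟩, hw, rfl⟩
  · linarith [circAbs_le_of_mem_nearAPinCY_dirDomY i q h0 hμ]
  · have h1 := circAbs_tshift_sub_le hMh hP w κ μ 1 (by norm_num)
    rw [← (shiftY_eq_tshift i κ w).1] at h1
    linarith [circAbs_le_of_mem_nearAPinCY_dirDomY i q hw hμ, circAbs_sub_le_add hN ((shiftY i κ w).1 μ) (w.1 μ) (ctrC q μ)]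
  · have h1 := circAbs_tshift_sub_le hMh hP w κ μ (-1) (by norm_num)
    rw [← (shiftY_eq_tshift i κ w).2] at h1
    linarith [circAbs_le_of_mem_nearAPinCY_dirDomY i q hw hμ, circAbs_sub_le_add hN (((shiftY i κ).symm w).1 μ) (w.1 μ) (ctrC q μ)]

end Extent

/-! ## §3  The aligned cube of `nD = 4R + 16L + 1` big `j`-blocks about `β` contains the chart preimage of the cut set -/

section Cube

variable (i : KIdx d ℓ hd hL b₀ b₁) (q : ↥(cubes (toKT i).D.toDomains))

/-- `4·(S_1 + … + S_{j−1}) ≤ S_j − S_1` for `j ≥ 1` (`S_{n+1} = L·S_n`, `L ≥ 5`). [cite: Balaban1984PropagatorsII, (2.1) p.224, bookkeeping] -/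
theorem four_mul_sum_sI_Ico_le : ∀ j : ℕ, 1 ≤ j → 4 * ∑ n ∈ Finset.Ico 1 j, sI ℓ (toKT i).Mh n ≤ sI ℓ (toKT i).Mh j - sI ℓ (toKT i).Mh 1 := by
  have hℓ : (4 : ℤ) ≤ (ℓ : ℤ) := by exact_mod_cast i.hℓ
  intro j hj
  induction j with
  | zero => omega
  | succ j ih =>
    rcases Nat.lt_or_ge j 1 with h0 | h1
    · have : j = 0 := by omega
      subst this
      simp
    · rw [Finset.sum_Ico_succ_top h1, mul_add, sI_succ]
      have := ih h1
      have hs : 0 ≤ sI ℓ (toKT i).Mh j := (sI_pos (toKT i).hMh j).le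
      nlinarith

/-- `S_{k′} ≤ L·S_j` (`k′ ≤ j + 1`). [cite: Balaban1985BackgroundPropagators, p.408 («{Ω_n(□)}_{n=0,…,j+1}»), bookkeeping] -/
theorem sTop_le_L_mul_sI : sTop ℓ (toKT i).Mh (kTop q) ≤ ((ℓ : ℤ) + 1) * sI ℓ (toKT i).Mh q.1.1 := by
  have hk : kTop q ≤ q.1.1 + 1 := min_le_left _ _
  have h : (toKT i).Mh * (ℓ + 1) ^ (kTop q + 1) ≤ (toKT i).Mh * (ℓ + 1) ^ (q.1.1 + 1 + 1) :=
    Nat.mul_le_mul_left _ (Nat.pow_le_pow_right (Nat.succ_pos ℓ) (by omega))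
  show ((bigSide ℓ (toKT i).Mh (kTop q) : ℕ) : ℤ) ≤ ((ℓ : ℤ) + 1) * ((bigSide ℓ (toKT i).Mh q.1.1 : ℕ) : ℤ)
  unfold bigSide
  have e : ((ℓ : ℤ) + 1) * (((toKT i).Mh * (ℓ + 1) ^ (q.1.1 + 1) : ℕ) : ℤ) = (((toKT i).Mh * (ℓ + 1) ^ (q.1.1 + 1 + 1) : ℕ) : ℤ) := by push_cast; ring
  rw [e]; exact_mod_cast h

/-- **THE HALF-COUNT `nHalfY = 2R + 8L`** of big `j`-blocks on either side of `β` in the datum cube (crude; `≈ 1.25R + 7L` would do). [cite: Balaban1985BackgroundPropagators, (3.35) p.396 («O(1)MLʲη»), p.408 («□⁵»), dictionary] -/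
def nHalfY : ℕ := 2 * (toKT i).R + 8 * (ℓ + 1)

/-- ★★ the extent of the cut set plus the half-block `hf_j` fits in `nHalfY + 1` big `j`-blocks: `w₁ + 4S_{k′} + 4 + hf_j < (nHalfY + 1)·S_j`.
[cite: Balaban1985BackgroundPropagators, p.408 («dist(Ω₀(□)ᶜ, □⁴) < 2R₀M₀Lʲη, hence Ω₀(□) ⊂ □⁵»), bookkeeping] -/
theorem extent_lt_nHalf : wid ℓ (toKT i).Mh (toKT i).R q.1.1 1 + 4 * sTop ℓ (toKT i).Mh (kTop q) + 4 + hf ℓ (toKT i).Mh q.1.1 < ((nHalfY i : ℤ) + 1) * sI ℓ (toKT i).Mh q.1.1 := by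
  have hMh := (toKT i).hMh
  have hj := B9CubeSequence408.one_le_cube_level q
  have hsum := four_mul_sum_sI_Ico_le i q.1.1 hj
  have hS1 : 0 < sI ℓ (toKT i).Mh 1 := sI_pos hMh 1
  have hS : 0 < sI ℓ (toKT i).Mh q.1.1 := sI_pos hMh _
  have h3S : (3 : ℤ) ≤ sI ℓ (toKT i).Mh q.1.1 := three_le_sTop hL hMh q.1.1
  have hhf : 2 * hf ℓ (toKT i).Mh q.1.1 + 1 = sI ℓ (toKT i).Mh q.1.1 := two_mul_hf_add_one hL.1 (oddMh i) q.1.1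
  have htop := sTop_le_L_mul_sI i q
  have hR : (0 : ℤ) ≤ ((toKT i).R : ℤ) := Nat.cast_nonneg _
  have hℓ : (4 : ℤ) ≤ (ℓ : ℤ) := by exact_mod_cast i.hℓ
  have hsum0 : 0 ≤ ∑ n ∈ Finset.Ico 1 q.1.1, sI ℓ (toKT i).Mh n := Finset.sum_nonneg fun n _ => (sI_pos hMh n).le
  have hSum4 : 4 * ∑ n ∈ Finset.Ico 1 q.1.1, sI ℓ (toKT i).Mh n ≤ sI ℓ (toKT i).Mh q.1.1 := by linarith
  have hprod : (((toKT i).R : ℤ) + 2) * (4 * ∑ n ∈ Finset.Ico 1 q.1.1, sI ℓ (toKT i).Mh n) ≤ (((toKT i).R : ℤ) + 2) * sI ℓ (toKT i).Mh q.1.1 :=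
    mul_le_mul_of_nonneg_left hSum4 (by positivity)
  have hRS : 0 ≤ ((toKT i).R : ℤ) * sI ℓ (toKT i).Mh q.1.1 := mul_nonneg hR hS.le
  have hℓS : 4 * sI ℓ (toKT i).Mh q.1.1 ≤ (ℓ : ℤ) * sI ℓ (toKT i).Mh q.1.1 := mul_le_mul_of_nonneg_right hℓ hS.le
  unfold nHalfY wid collar
  push_cast
  ring_nf
  ring_nf at hprod htop hRS hℓS hhf
  linarith

/-- **THE CORNER OF THE DATUM CUBE**: the V1 site with coordinates `(β_μ − nHalfY)·S_j (mod N₀)`. [cite: Balaban1985BackgroundPropagators, (3.35) p.396 («□ is a union of several big blocks»), dictionary] -/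
def cornerYCut : Site (PV d ℓ i.m i.K hd hL) 0 := fun μ => (((q.1.2 μ - (nHalfY i : ℤ)) * sI ℓ (toKT i).Mh q.1.1 : ℤ) : ZMod ((PV d ℓ i.m i.K hd hL).sitesPerDir 0))

/-- the corner lies on the big-`j`-block grid: `S_j ∣ val (cornerYCut_μ)` (`S_j ∣ N₀`). [cite: Balaban1985BackgroundPropagators, (3.35) p.396, bookkeeping] -/
theorem bigSide_dvd_cornerYCut_val (μ : Fin (d + 1)) : bigSide ℓ (toKT i).Mh q.1.1 ∣ (cornerYCut i q μ).val := by
  haveI : NeZero ((PV d ℓ i.m i.K hd hL).sitesPerDir 0) := NeZero.of_pos (lt_trans zero_lt_one ((PV d ℓ i.m i.K hd hL).one_lt_sitesPerDir 0))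
  have hN : sI ℓ (toKT i).Mh q.1.1 ∣ (((PV d ℓ i.m i.K hd hL).sitesPerDir 0 : ℕ) : ℤ) := by
    rw [← i.hN μ]; exact B9CubeSequence408.sI_dvd_N0 i.P' (B9CubeSequence408.cube_level_le q) μ
  have h : (sI ℓ (toKT i).Mh q.1.1 : ℤ) ∣ ((cornerYCut i q μ).val : ℤ) := by
    unfold cornerYCut
    rw [ZMod.val_intCast, Int.emod_def]
    exact dvd_sub (dvd_mul_left _ _) (dvd_mul_of_dvd_left hN _)
  unfold sI at h
  exact_mod_cast h

/-- the chart of the corner: `val (cornerYCut_μ) ≡ (β_μ − nHalfY)·S_j (mod N₀)`. [cite: Balaban1984PropagatorsII, (2.1) p.224, bookkeeping] -/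
theorem cornerYCut_val_eq (μ : Fin (d + 1)) :
    ((cornerYCut i q μ).val : ℤ) = ((q.1.2 μ - (nHalfY i : ℤ)) * sI ℓ (toKT i).Mh q.1.1) % (((toKT i).NB μ : ℕ) : ℤ) := by
  haveI : NeZero ((PV d ℓ i.m i.K hd hL).sitesPerDir 0) := NeZero.of_pos (lt_trans zero_lt_one ((PV d ℓ i.m i.K hd hL).one_lt_sitesPerDir 0))
  unfold cornerYCut
  rw [ZMod.val_intCast, show (toKT i).NB μ = (PV d ℓ i.m i.K hd hL).sitesPerDir 0 from i.hN μ]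

/-- membership in the datum cube read on box coordinates: `x ∈ torusCube (cornerYCut) s` iff `(val x_μ − (β_μ − nHalfY)·S_j) mod N₀ < s` for all `μ`.
[cite: Balaban1985BackgroundPropagators, p.396 («a class of cubes»), bookkeeping] -/
theorem mem_torusCube_cornerYCut_iff (x : Site (PV d ℓ i.m i.K hd hL) 0) (s : ℕ) :
    x ∈ torusCube (cornerYCut i q) s ↔ ∀ μ, ((((x μ).val : ℤ) - (q.1.2 μ - (nHalfY i : ℤ)) * sI ℓ (toKT i).Mh q.1.1) % (((toKT i).NB μ : ℕ) : ℤ)) < s := by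
  haveI : NeZero ((PV d ℓ i.m i.K hd hL).sitesPerDir 0) := NeZero.of_pos (lt_trans zero_lt_one ((PV d ℓ i.m i.K hd hL).one_lt_sitesPerDir 0))
  have key : ∀ μ, (((x μ - cornerYCut i q μ).val : ℤ)) = ((((x μ).val : ℤ) - (q.1.2 μ - (nHalfY i : ℤ)) * sI ℓ (toKT i).Mh q.1.1) % (((toKT i).NB μ : ℕ) : ℤ)) := by
    intro μ
    have e : x μ - cornerYCut i q μ = (((((x μ).val : ℤ) - (q.1.2 μ - (nHalfY i : ℤ)) * sI ℓ (toKT i).Mh q.1.1 : ℤ)) : ZMod ((PV d ℓ i.m i.K hd hL).sitesPerDir 0)) := by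
      unfold cornerYCut; push_cast; rw [ZMod.natCast_zmod_val]
    rw [e, ZMod.val_intCast, show (toKT i).NB μ = (PV d ℓ i.m i.K hd hL).sitesPerDir 0 from i.hN μ]
  unfold torusCube
  simp only [Set.mem_setOf_eq]
  constructor
  · intro h μ; rw [← key μ]; exact_mod_cast h μ
  · intro h μ; have := h μ; rw [← key μ] at this; exact_mod_cast this

/-- ★★★ **THE CHART PREIMAGE OF THE CUT SET LIES IN THE ALIGNED CUBE** `torusCube (cornerYCut i □) ((2·nHalfY + 1)·S_j)` of `4R + 16L + 1` big `j`-blocks, when every direction of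
`□` is mirrored — ✓D1's hypothesis `hbox`. [cite: Balaban1985BackgroundPropagators, p.408 («Ω₀(□) ⊂ □⁵»), Cor. 3.6 p.408 l.1–14 («the cube □⁵ is contained in one of the cubes for which this condition holds»), p.410 l.14–15] -/
theorem bondCutSetY_subset_torusCube (hmir : ∀ μ, mirC q μ = true) :
    ∀ z ∈ bondCutSetY i q, (boxEquiv i.hN).symm z ∈ torusCube (cornerYCut i q) ((2 * nHalfY i + 1) * bigSide ℓ (toKT i).Mh q.1.1) := by
  intro z hz
  rw [mem_torusCube_cornerYCut_iff]
  intro μ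
  have hMh := (toKT i).hMh
  have hP := (toKT i).hP
  have hN : 1 ≤ (toKT i).NB μ := one_le_N0 hMh hP μ
  have hN0 : (0 : ℤ) < (((toKT i).NB μ : ℕ) : ℤ) := by exact_mod_cast hN
  have hW := circAbs_le_of_mem_bondCutSetY i q hz (hmir μ)
  have hext := extent_lt_nHalf i q
  have hhf : 2 * hf ℓ (toKT i).Mh q.1.1 + 1 = sI ℓ (toKT i).Mh q.1.1 := two_mul_hf_add_one hL.1 (oddMh i) q.1.1
  have hS : 0 < sI ℓ (toKT i).Mh q.1.1 := sI_pos hMh _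
  have hn0 : (0 : ℤ) ≤ (nHalfY i : ℤ) := Nat.cast_nonneg _
  rw [B6GlobalChartV1.val_boxEquiv_symm]
  -- the centred representative `t = z_μ − c_μ + N₀r`, `|t| ≤ W`
  set r := centre ((toKT i).NB μ) (z.1 μ - ctrC q μ) with hr
  have habs : |z.1 μ - ctrC q μ + (((toKT i).NB μ : ℕ) : ℤ) * r| ≤ wid ℓ (toKT i).Mh (toKT i).R q.1.1 1 + 4 * sTop ℓ (toKT i).Mh (kTop q) + 4 := by
    rw [abs_add_mul_centre hN]; exact hW
  obtain ⟨hlo, hhi⟩ := abs_le.1 habs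
  -- `val z_μ − (β_μ − nHalf)S_j = t + hf_j + nHalf·S_j − N₀r`
  have e : z.1 μ - (q.1.2 μ - (nHalfY i : ℤ)) * sI ℓ (toKT i).Mh q.1.1 =
      (z.1 μ - ctrC q μ + (((toKT i).NB μ : ℕ) : ℤ) * r + hf ℓ (toKT i).Mh q.1.1 + (nHalfY i : ℤ) * sI ℓ (toKT i).Mh q.1.1) + (((toKT i).NB μ : ℕ) : ℤ) * (-r) := by
    unfold ctrC; ring
  rw [e, Int.add_mul_emod_self_left]
  set u := z.1 μ - ctrC q μ + (((toKT i).NB μ : ℕ) : ℤ) * r + hf ℓ (toKT i).Mh q.1.1 + (nHalfY i : ℤ) * sI ℓ (toKT i).Mh q.1.1 with hu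
  have hnS : (nHalfY i : ℤ) * sI ℓ (toKT i).Mh q.1.1 = ((nHalfY i : ℤ) + 1) * sI ℓ (toKT i).Mh q.1.1 - sI ℓ (toKT i).Mh q.1.1 := by ring
  have hc : (((2 * nHalfY i + 1) * bigSide ℓ (toKT i).Mh q.1.1 : ℕ) : ℤ) = (nHalfY i : ℤ) * sI ℓ (toKT i).Mh q.1.1 + ((nHalfY i : ℤ) + 1) * sI ℓ (toKT i).Mh q.1.1 := by
    unfold sI; push_cast; ring
  have hu0 : 0 ≤ u := by rw [hu]; linarith
  have hu1 : u < (((2 * nHalfY i + 1) * bigSide ℓ (toKT i).Mh q.1.1 : ℕ) : ℤ) := by rw [hu, hc]; linarith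
  have hmod : u % (((toKT i).NB μ : ℕ) : ℤ) ≤ u := by
    have h1 := Int.mul_ediv_add_emod u (((toKT i).NB μ : ℕ) : ℤ)
    have h2 : 0 ≤ u / (((toKT i).NB μ : ℕ) : ℤ) := Int.ediv_nonneg hu0 hN0.le
    nlinarith
  exact lt_of_le_of_lt hmod hu1

/-- the witness site of `β` (member level `j`) lies in the datum cube (its coordinates are in `[β_μS_j, (β_μ+1)S_j)`). [cite: Balaban1984PropagatorsII, p.229 («with a center y ∈ Λ_j»), bookkeeping] -/
theorem wit_mem_torusCube :
    (boxEquiv i.hN).symm (wit (toKT i).D.toDomains q) ∈ torusCube (cornerYCut i q) ((2 * nHalfY i + 1) * bigSide ℓ (toKT i).Mh q.1.1) := by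
  rw [mem_torusCube_cornerYCut_iff]
  intro μ
  have hMh := (toKT i).hMh
  have hP := (toKT i).hP
  have hN : 1 ≤ (toKT i).NB μ := one_le_N0 hMh hP μ
  have hN0 : (0 : ℤ) < (((toKT i).NB μ : ℕ) : ℤ) := by exact_mod_cast hN
  have hS : 0 < sI ℓ (toKT i).Mh q.1.1 := sI_pos hMh _
  rw [B6GlobalChartV1.val_boxEquiv_symm]
  have hw : |(wit (toKT i).D.toDomains q).1 μ - ctrC q μ| ≤ hf ℓ (toKT i).Mh q.1.1 :=
    abs_sub_ctrC_le_of_blk_eq hL.1 (oddMh i) hMh q (blk_wit (toKT i).D.toDomains q) μ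
  obtain ⟨hlo, hhi⟩ := abs_le.1 hw
  have hhf : 2 * hf ℓ (toKT i).Mh q.1.1 + 1 = sI ℓ (toKT i).Mh q.1.1 := two_mul_hf_add_one hL.1 (oddMh i) q.1.1
  have hn0 : (0 : ℤ) ≤ (nHalfY i : ℤ) := Nat.cast_nonneg _
  have e : (wit (toKT i).D.toDomains q).1 μ - (q.1.2 μ - (nHalfY i : ℤ)) * sI ℓ (toKT i).Mh q.1.1 =
      ((wit (toKT i).D.toDomains q).1 μ - ctrC q μ) + hf ℓ (toKT i).Mh q.1.1 + (nHalfY i : ℤ) * sI ℓ (toKT i).Mh q.1.1 := by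
    unfold ctrC; ring
  show ((wit (toKT i).D.toDomains q).1 μ - (q.1.2 μ - (nHalfY i : ℤ)) * sI ℓ (toKT i).Mh q.1.1) % (((toKT i).NB μ : ℕ) : ℤ) <
    (((2 * nHalfY i + 1) * bigSide ℓ (toKT i).Mh q.1.1 : ℕ) : ℤ)
  rw [e]
  set u := ((wit (toKT i).D.toDomains q).1 μ - ctrC q μ) + hf ℓ (toKT i).Mh q.1.1 + (nHalfY i : ℤ) * sI ℓ (toKT i).Mh q.1.1 with hu
  have hnS : 0 ≤ (nHalfY i : ℤ) * sI ℓ (toKT i).Mh q.1.1 := mul_nonneg hn0 hS.le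
  have hc : (((2 * nHalfY i + 1) * bigSide ℓ (toKT i).Mh q.1.1 : ℕ) : ℤ) = 2 * ((nHalfY i : ℤ) * sI ℓ (toKT i).Mh q.1.1) + sI ℓ (toKT i).Mh q.1.1 := by
    unfold sI; push_cast; ring
  have hu0 : 0 ≤ u := by rw [hu]; linarith
  have hu1 : u < (((2 * nHalfY i + 1) * bigSide ℓ (toKT i).Mh q.1.1 : ℕ) : ℤ) := by rw [hu, hc]; linarith
  have hmod : u % (((toKT i).NB μ : ℕ) : ℤ) ≤ u := by
    have e1 := Int.mul_ediv_add_emod u (((toKT i).NB μ : ℕ) : ℤ)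
    have e2 : 0 ≤ u / (((toKT i).NB μ : ℕ) : ℤ) := Int.ediv_nonneg hu0 hN0.le
    nlinarith
  exact lt_of_le_of_lt hmod hu1

/-- the member level of the witness of `β`, read through the chart: `levV1 i (chart⁻¹ w_β) = j`. [cite: Balaban1984PropagatorsII, p.229, bookkeeping] -/
theorem levV1_wit : B9BackgroundsKLevelV1.levV1 i ((boxEquiv i.hN).symm (wit (toKT i).D.toDomains q)) = q.1.1 := by
  unfold B9BackgroundsKLevelV1.levV1
  rw [← B6GlobalChartV1.boxEquiv_apply, Equiv.apply_symm_apply]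
  exact lev_wit (toKT i).D.toDomains q

/-- ★ the box coordinates of a site of the datum cube are within `nHalfY·S_j + hf_j` of the centre of `β` (torus distance) — the input of the LEVEL half (next file).
[cite: Balaban1985BackgroundPropagators, (3.35) p.396, p.408, bookkeeping] -/
theorem circAbs_le_of_mem_torusCube_cornerYCut {x : Site (PV d ℓ i.m i.K hd hL) 0}
    (hx : x ∈ torusCube (cornerYCut i q) ((2 * nHalfY i + 1) * bigSide ℓ (toKT i).Mh q.1.1)) (μ : Fin (d + 1)) :
    circAbs ((toKT i).NB μ) ((toBox i.hN x).1 μ - ctrC q μ) ≤ (nHalfY i : ℤ) * sI ℓ (toKT i).Mh q.1.1 + hf ℓ (toKT i).Mh q.1.1 := by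
  rw [mem_torusCube_cornerYCut_iff] at hx
  have h := hx μ
  have hMh := (toKT i).hMh
  have hP := (toKT i).hP
  have hN : 1 ≤ (toKT i).NB μ := one_le_N0 hMh hP μ
  have hN0 : (0 : ℤ) < (((toKT i).NB μ : ℕ) : ℤ) := by exact_mod_cast hN
  have hhf : 2 * hf ℓ (toKT i).Mh q.1.1 + 1 = sI ℓ (toKT i).Mh q.1.1 := two_mul_hf_add_one hL.1 (oddMh i) q.1.1
  have hS : 0 < sI ℓ (toKT i).Mh q.1.1 := sI_pos hMh _
  set a := ((x μ).val : ℤ) - (q.1.2 μ - (nHalfY i : ℤ)) * sI ℓ (toKT i).Mh q.1.1 with ha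
  have h0 := Int.emod_nonneg a hN0.ne'
  have h1 := Int.mul_ediv_add_emod a (((toKT i).NB μ : ℕ) : ℤ)
  -- `val x_μ − c_μ = (a mod N₀) − nHalf·S_j − hf_j + N₀·(a / N₀)`
  have e : (toBox i.hN x).1 μ - ctrC q μ = (a % (((toKT i).NB μ : ℕ) : ℤ) - (nHalfY i : ℤ) * sI ℓ (toKT i).Mh q.1.1 - hf ℓ (toKT i).Mh q.1.1) +
      (((toKT i).NB μ : ℕ) : ℤ) * (a / (((toKT i).NB μ : ℕ) : ℤ)) := by
    have ea : ((x μ).val : ℤ) = a + (q.1.2 μ - (nHalfY i : ℤ)) * sI ℓ (toKT i).Mh q.1.1 := by rw [ha]; ring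
    rw [B6GlobalChartV1.toBox_apply, ea]; unfold ctrC; linear_combination -h1
  rw [e, circAbs_add_mul]
  have hlt : a % (((toKT i).NB μ : ℕ) : ℤ) < (2 * (nHalfY i : ℤ) + 1) * sI ℓ (toKT i).Mh q.1.1 := by
    have : a % (((toKT i).NB μ : ℕ) : ℤ) < (((2 * nHalfY i + 1) * bigSide ℓ (toKT i).Mh q.1.1 : ℕ) : ℤ) := h
    unfold sI; push_cast at this ⊢; linarith
  have hnS : 0 ≤ (nHalfY i : ℤ) * sI ℓ (toKT i).Mh q.1.1 := mul_nonneg (Nat.cast_nonneg _) hS.le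
  have e2 : (2 * (nHalfY i : ℤ) + 1) * sI ℓ (toKT i).Mh q.1.1 = 2 * ((nHalfY i : ℤ) * sI ℓ (toKT i).Mh q.1.1) + sI ℓ (toKT i).Mh q.1.1 := by ring
  refine (circAbs_le_abs hN _).trans (abs_le.2 ⟨by linarith, by linarith⟩)

end Cube

end Literature.MathematicalPhysics.QuantumFieldTheory.Balaban1983to89.B9Cor36GDirBondCutSetExtent

end
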